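import Literature.Geometry.Riemannian.ThreeShrinkerCompactReduction
import Literature.Geometry.Lorentzian.CoordRicciDeterminantLaplacian
import Literature.Geometry.Lorentzian.CoordRicciEvolution
import Literature.Geometry.Lorentzian.HessianLocalMax
import Literature.Geometry.Riemannian.HamiltonMaximumPrincipleSpatial
import HarnessLib

/-!
# Compact three-dimensional shrinkers: the degenerate case and the compact classification

We exclude the degenerate alternative of
`ThreeShrinker.modelData_or_ricci_degenerate_of_compactSpace` (`ThreeShrinkerCompactReduction`):
on a compact connected three-dimensional gradient shrinking soliton `Ric + Hess φ = ½ h` with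
`Ric ≥ 0` there is no point with a null vector of `Ric`. Consequently
(**`ThreeShrinker.modelData_of_compactSpace`**) every COMPACT member of the binder of
`threeShrinkerClassification_modelData` satisfies its conclusion (alternative (a): a quotient of
the round `S³` of scalar curvature `3/2`).

The source (Eminenti–La Nave–Mantegazza 2008, §3, p. 8, second case) argues with a smooth local
eigenvector of the simple eigenvalue `λ_min(Ric)` and the strong maximum principle (alternatively
with Hamilton's strong maximum principle for tensors). We replace the eigenvector by the smooth
barrier **`u = det(♯Ric)`** (`CoordRicciDeterminant`): `u ≥ 0` (as `Ric ≥ 0`), its zero set is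
the set of points with a null vector, and by the eigenframe computation of
`CoordRicciDeterminantLaplacian.IsMetricOn.lapAt_ricDetAt_le_of_soliton` it satisfies, near a zero
`p` (where the eigenvalues are `(0, S/2, S/2)` by the minimum-point analysis
`ShrinkerPinchingEigenvalues`, so `μ₁μ₂ ≥ c > 0` nearby by continuity of
`σ₂ = ½(S² − |Ric|²)`), a linear inequality `−g^{ij}∂ᵢⱼu + bⁱ∂ᵢu + C u ≥ 0` with coefficients
BOUNDED on compacts (the drift `b` is built from a pointwise eigenframe and need not be continuous —
E. Hopf's minimum principle `Literature.Analysis.PDE.hopf_minimumPrinciple_eventually_eq` allows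
this). Hence `u ≡ 0` near `p` (`ricci_null_eventually_of_soliton`): the null set of `Ric` is open;
it is closed (`isClosed_ricci_null`), so on a connected `N` it is everything, and at a maximum point
of `φ` a null vector `w` gives `Hess φ(w,w) = ½|w|² > 0`, contradicting
`hessian_apply_self_nonpos_of_isLocalMax`.

Everything is proved; no definitions are introduced.

## References

* M. Eminenti, G. La Nave, C. Mantegazza, *Ricci solitons: the equation point of view*,
  manuscripta math. 127 (2008), §3 (pp. 7–8), Prop. 3.7. [EminentiLanaveMantegazza2008]
* J. López-Gómez, *Linear Second Order Elliptic Operators*, 2013, Thm. 1.2. [LopezGomez2012]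
* O. Munteanu, J. Wang, arXiv:1606.01861, Thm. 1.2 (p. 3). [MunteanuWang2016]
-/

noncomputable section

set_option maxSynthPendingDepth 3

open Bundle Set Function Filter Module Metric
open scoped Manifold ContDiff Topology

namespace Literature.Geometry.Lorentzian

namespace MetricCoord

/-! ### Coordinate preliminaries -/

variable {E : Type*} [NormedAddCommGroup E] [NormedSpace ℝ E] [FiniteDimensional ℝ E]
  {G : E → E →L[ℝ] E →L[ℝ] ℝ} {V : Set E} {y : E}

/-- A sorted orthonormal eigenframe of a symmetric form in dimension three:
`μ₀ ≤ μ₁ ≤ μ₂`. [cite: ONeill1983, Ch. 9, Lemma 9.13] -/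
theorem exists_sorted_eigenframe_three (h3 : finrank ℝ E = 3) (hs : ∀ v w, G y v w = G y w v)
    (hpos : ∀ v, v ≠ 0 → 0 < G y v v) (β : E →L[ℝ] E →L[ℝ] ℝ) (hβ : ∀ v w, β v w = β w v) :
    ∃ (e : Basis (Fin 3) ℝ E) (μ : Fin 3 → ℝ),
      (∀ i j, G y (e i) (e j) = if i = j then 1 else 0) ∧
        (∀ i w, β (e i) w = μ i * G y (e i) w) ∧ μ 0 ≤ μ 1 ∧ μ 1 ≤ μ 2 := by
  obtain ⟨e'', μ'', he'', hμ''⟩ := exists_orthonormal_eigenframe hs hpos β hβ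
  set e' : Basis (Fin 3) ℝ E := e''.reindex (finCongr h3) with he'def
  set μ' : Fin 3 → ℝ := μ'' ∘ (finCongr h3).symm with hμ'def
  have he' : ∀ i j, G y (e' i) (e' j) = if i = j then 1 else 0 := fun i j ↦ by
    rw [he'def, Basis.reindex_apply, Basis.reindex_apply, he'']
    simp only [finCongr_symm, finCongr_apply, Fin.cast_inj]
  have hμ' : ∀ i w, β (e' i) w = μ' i * G y (e' i) w := fun i w ↦ by
    rw [he'def, Basis.reindex_apply, hμ'', hμ'def, Function.comp_apply]
  obtain ⟨j, -, hj⟩ := Finset.exists_min_image Finset.univ μ' Finset.univ_nonempty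
  obtain ⟨σ, hσ0, hσle⟩ := Riemannian.exists_perm_fin_three j μ'
  set e : Basis (Fin 3) ℝ E := e'.reindex σ.symm with hedef
  have heσ : ∀ i, e i = e' (σ i) := fun i ↦ by rw [hedef, Basis.reindex_apply, Equiv.symm_symm]
  refine ⟨e, μ' ∘ σ, fun i k ↦ ?_, fun i w ↦ ?_, ?_, hσle⟩
  · rw [heσ, heσ, he']
    simp only [EmbeddingLike.apply_eq_iff_eq]
  · rw [heσ, hμ', Function.comp_apply]
  · rw [Function.comp_apply, Function.comp_apply, hσ0]
    exact hj _ (Finset.mem_univ _)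

omit [FiniteDimensional ℝ E] in
/-- Orthonormal vectors have norm `≤ A` once `G_y ≥ ν‖·‖²` with `ν A² ≥ 1`. [folklore] -/
theorem norm_le_of_le_quadratic {ν A : ℝ} (hν : 0 < ν) (hA : 0 ≤ A)
    (hνA : 1 ≤ ν * A ^ 2) (hle : ∀ v : E, ν * ‖v‖ ^ 2 ≤ G y v v) {v : E} (hv : G y v v = 1) :
    ‖v‖ ≤ A := by
  have h1 : ν * ‖v‖ ^ 2 ≤ 1 := hv ▸ hle v
  have h2 : ‖v‖ ^ 2 ≤ A ^ 2 := le_of_mul_le_mul_left (h1.trans hνA) hν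
  exact (pow_le_pow_iff_left₀ (norm_nonneg v) hA two_ne_zero).mp h2

variable [CompleteSpace E]

/-- **The barrier inequality in operator form**: with a sorted non-negative eigenframe,
`μ₁μ₂ ≥ c > 0` and `|K| ≤ K₀`, the inequality of
`IsMetricOn.lapAt_ricDetAt_le_of_soliton` becomes `Δu − du(∇f) − du(Y) ≤ (K₀/c)·u` for the drift
vector `Y = Σ_k Y_k e_k` (`u = μ₀μ₁μ₂`). [cite: EminentiLanaveMantegazza2008, §3, p. 8] -/
theorem IsMetricOn.lapAt_ricDetAt_le_mul (hG : IsMetricOn G V) (hy : y ∈ V)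
    (h3 : finrank ℝ E = 3) (e : Basis (Fin 3) ℝ E)
    (he : ∀ i j, G y (e i) (e j) = if i = j then 1 else 0)
    {μ : Fin 3 → ℝ} (hμ : ∀ i w, ricAt G y (e i) w = μ i * G y (e i) w)
    {f : E → ℝ} {lam : ℝ} (hf : ContDiffOn ℝ ∞ f V)
    (hsol : ∀ z ∈ V, ∀ v w, ricAt G z v w + hessAt G f z v w = lam * G z v w)
    (h0 : 0 ≤ μ 0) (h1 : 0 ≤ μ 1) (h2 : 0 ≤ μ 2) {c K₀ : ℝ} (hc : 0 < c)
    (hcμ : c ≤ μ 1 * μ 2)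
    (hK : |μ 1 * μ 2 * (2 * lam - μ 1 - μ 2)
        + μ 2 * (2 * lam * μ 1 - μ 0 * (μ 1 + μ 0 - μ 2) - μ 2 * (μ 1 + μ 2 - μ 0))
        + μ 1 * (2 * lam * μ 2 - μ 0 * (μ 2 + μ 0 - μ 1) - μ 1 * (μ 2 + μ 1 - μ 0))
        + ∑ k, 2 * (cov₂At G (ricAt G) y (e k) (e 1) (e 1) * cov₂At G (ricAt G) y (e k) (e 2) (e 2)
            - cov₂At G (ricAt G) y (e k) (e 1) (e 2) ^ 2)| ≤ K₀) :
    lapAt G (ricDetAt G) y - fderiv ℝ (ricDetAt G) y (sharpAt G y (fderiv ℝ f y))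
        - fderiv ℝ (ricDetAt G) y (∑ k, (2 * (μ 2 * cov₂At G (ricAt G) y (e k) (e 1) (e 1)
            + μ 1 * cov₂At G (ricAt G) y (e k) (e 2) (e 2)) / (μ 1 * μ 2)) • e k) ≤
      K₀ / c * ricDetAt G y := by
  have h12 : 0 < μ 1 * μ 2 := hc.trans_le hcμ
  have hmain := hG.lapAt_ricDetAt_le_of_soliton hy h3 e he hμ hf hsol h0 h1 h2 h12
  have hsum : fderiv ℝ (ricDetAt G) y (∑ k, (2 * (μ 2 * cov₂At G (ricAt G) y (e k) (e 1) (e 1)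
        + μ 1 * cov₂At G (ricAt G) y (e k) (e 2) (e 2)) / (μ 1 * μ 2)) • e k) =
      ∑ k, 2 * (μ 2 * cov₂At G (ricAt G) y (e k) (e 1) (e 1)
        + μ 1 * cov₂At G (ricAt G) y (e k) (e 2) (e 2)) / (μ 1 * μ 2)
        * fderiv ℝ (ricDetAt G) y (e k) := by
    simp only [map_sum, map_smul, smul_eq_mul]
  rw [hsum]
  have hu : ricDetAt G y = μ 0 * (μ 1 * μ 2) := by
    rw [ricDetAt_eq_prod_of_eigenframe e he (hG.isInvertible y hy) hμ, Fin.prod_univ_three, mul_assoc]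
  have hK0 : 0 ≤ K₀ := (abs_nonneg _).trans hK
  have hstep : μ 0 * K₀ ≤ K₀ / c * ricDetAt G y := by
    rw [hu, div_mul_eq_mul_div, le_div_iff₀ hc]
    have : μ 0 * K₀ * c ≤ μ 0 * K₀ * (μ 1 * μ 2) :=
      mul_le_mul_of_nonneg_left hcμ (mul_nonneg h0 hK0)
    linarith
  exact hmain.trans ((mul_le_mul_of_nonneg_left (le_abs_self _) h0).trans
    ((mul_le_mul_of_nonneg_left hK h0).trans hstep))

omit [CompleteSpace E] in
/-- `|a + b + c + d| ≤ |a| + |b| + |c| + |d|`. [folklore] -/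
private theorem abs_add_four_le (a b c d : ℝ) : |a + b + c + d| ≤ |a| + |b| + |c| + |d| := by
  have h1 := abs_add_le (a + b + c) d
  have h2 := abs_add_le (a + b) c
  have h3 := abs_add_le a b
  linarith

omit [CompleteSpace E] in
/-- **Bounds for the barrier coefficients**: if `‖Ric_y‖, ‖∇Ric_y‖ ≤ A`, `|λ| ≤ A`, the frame
vectors have norm `≤ A` and `A ≥ 1`, then `|K| ≤ 32 A⁹` and the drift numerators satisfy
`|2(μ₂B⁽ᵏ⁾₁₁ + μ₁B⁽ᵏ⁾₂₂)| ≤ 4 A⁷`. [folklore] -/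
theorem IsMetricOn.abs_barrierCoeff_le (hG : IsMetricOn G V) (hy : y ∈ V) (e : Basis (Fin 3) ℝ E)
    (he : ∀ i j, G y (e i) (e j) = if i = j then 1 else 0)
    {μ : Fin 3 → ℝ} (hμ : ∀ i w, ricAt G y (e i) w = μ i * G y (e i) w) {A lam : ℝ}
    (hA1 : 1 ≤ A) (hRic : ‖ricAt G y‖ ≤ A) (hB : ‖cov₂At G (ricAt G) y‖ ≤ A)
    (hen : ∀ i, ‖e i‖ ≤ A) (hlam : |lam| ≤ A) :
    |μ 1 * μ 2 * (2 * lam - μ 1 - μ 2)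
        + μ 2 * (2 * lam * μ 1 - μ 0 * (μ 1 + μ 0 - μ 2) - μ 2 * (μ 1 + μ 2 - μ 0))
        + μ 1 * (2 * lam * μ 2 - μ 0 * (μ 2 + μ 0 - μ 1) - μ 1 * (μ 2 + μ 1 - μ 0))
        + ∑ k, 2 * (cov₂At G (ricAt G) y (e k) (e 1) (e 1) * cov₂At G (ricAt G) y (e k) (e 2) (e 2)
            - cov₂At G (ricAt G) y (e k) (e 1) (e 2) ^ 2)| ≤ 32 * A ^ 9 ∧
      ∀ k, |2 * (μ 2 * cov₂At G (ricAt G) y (e k) (e 1) (e 1)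
          + μ 1 * cov₂At G (ricAt G) y (e k) (e 2) (e 2))| ≤ 4 * A ^ 7 := by
  have _hi := hG.isInvertible y hy
  have hA0 : 0 ≤ A := zero_le_one.trans hA1
  have hApow : ∀ m n : ℕ, m ≤ n → A ^ m ≤ A ^ n := fun m n hmn ↦ pow_le_pow_right₀ hA1 hmn
  -- the frame components
  have hdiag : ∀ i, ricAt G y (e i) (e i) = μ i := fun i ↦ by rw [hμ, he]; simp
  have hμb : ∀ i, |μ i| ≤ A ^ 3 := fun i ↦ by
    rw [← hdiag, ← Real.norm_eq_abs]
    calc ‖ricAt G y (e i) (e i)‖ ≤ ‖ricAt G y‖ * ‖e i‖ * ‖e i‖ := (ricAt G y).le_opNorm₂ _ _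
      _ ≤ A * A * A := by gcongr <;> first | exact hRic | exact hen i
      _ = A ^ 3 := by ring
  have hBb : ∀ k i j, |cov₂At G (ricAt G) y (e k) (e i) (e j)| ≤ A ^ 4 := fun k i j ↦ by
    rw [← Real.norm_eq_abs]
    calc ‖cov₂At G (ricAt G) y (e k) (e i) (e j)‖
        ≤ ‖cov₂At G (ricAt G) y (e k)‖ * ‖e i‖ * ‖e j‖ := (cov₂At G (ricAt G) y (e k)).le_opNorm₂ _ _
      _ ≤ ‖cov₂At G (ricAt G) y‖ * ‖e k‖ * ‖e i‖ * ‖e j‖ := by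
          gcongr; exact (cov₂At G (ricAt G) y).le_opNorm _
      _ ≤ A * A * A * A := by gcongr <;> first | exact hB | exact hen _
      _ = A ^ 4 := by ring
  -- `|μᵢ| ≤ A³` as two-sided bounds, `|λ| ≤ A`
  have hμl : ∀ i, -A ^ 3 ≤ μ i := fun i ↦ (abs_le.mp (hμb i)).1
  have hμu : ∀ i, μ i ≤ A ^ 3 := fun i ↦ (abs_le.mp (hμb i)).2
  have hlaml : -A ≤ lam := (abs_le.mp hlam).1
  have hlamu : lam ≤ A := (abs_le.mp hlam).2
  have hA3 : A ≤ A ^ 3 := by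
    calc A = A ^ 1 := (pow_one A).symm
      _ ≤ A ^ 3 := hApow 1 3 (by norm_num)
  refine ⟨?_, fun k ↦ ?_⟩
  · -- the four groups of `K`
    have hT1 : |μ 1 * μ 2 * (2 * lam - μ 1 - μ 2)| ≤ 4 * A ^ 9 := by
      rw [abs_mul, abs_mul]
      have hl : |2 * lam - μ 1 - μ 2| ≤ 2 * A + A ^ 3 + A ^ 3 := by
        rw [abs_le]; constructor <;> linarith [hμl 1, hμl 2, hμu 1, hμu 2]
      calc |μ 1| * |μ 2| * |2 * lam - μ 1 - μ 2| ≤ A ^ 3 * A ^ 3 * (2 * A + A ^ 3 + A ^ 3) := by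
            gcongr <;> exact hμb _
        _ = 2 * A ^ 7 + 2 * A ^ 9 := by ring
        _ ≤ 4 * A ^ 9 := by linarith [hApow 7 9 (by norm_num)]
    have hTi : ∀ i j k : Fin 3,
        |μ i * (2 * lam * μ j - μ k * (μ j + μ k - μ i) - μ i * (μ j + μ i - μ k))| ≤ 8 * A ^ 9 := by
      intro i j k
      rw [abs_mul]
      have hin : |2 * lam * μ j - μ k * (μ j + μ k - μ i) - μ i * (μ j + μ i - μ k)| ≤
          2 * A * A ^ 3 + A ^ 3 * (3 * A ^ 3) + A ^ 3 * (3 * A ^ 3) := by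
        have h1 : |2 * lam * μ j| ≤ 2 * A * A ^ 3 := by
          rw [abs_mul, abs_mul, show |(2 : ℝ)| = 2 from by norm_num]
          gcongr; exact hμb _
        have h2 : |μ k * (μ j + μ k - μ i)| ≤ A ^ 3 * (3 * A ^ 3) := by
          rw [abs_mul]
          have : |μ j + μ k - μ i| ≤ 3 * A ^ 3 := by
            rw [abs_le]; constructor <;> linarith [hμl i, hμl j, hμl k, hμu i, hμu j, hμu k]
          gcongr; exact hμb _
        have h3 : |μ i * (μ j + μ i - μ k)| ≤ A ^ 3 * (3 * A ^ 3) := by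
          rw [abs_mul]
          have : |μ j + μ i - μ k| ≤ 3 * A ^ 3 := by
            rw [abs_le]; constructor <;> linarith [hμl i, hμl j, hμl k, hμu i, hμu j, hμu k]
          gcongr; exact hμb _
        have := abs_sub (2 * lam * μ j - μ k * (μ j + μ k - μ i)) (μ i * (μ j + μ i - μ k))
        have := abs_sub (2 * lam * μ j) (μ k * (μ j + μ k - μ i))
        linarith
      calc |μ i| * |2 * lam * μ j - μ k * (μ j + μ k - μ i) - μ i * (μ j + μ i - μ k)|
          ≤ A ^ 3 * (2 * A * A ^ 3 + A ^ 3 * (3 * A ^ 3) + A ^ 3 * (3 * A ^ 3)) := by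
            gcongr; exact hμb _
        _ = 2 * A ^ 7 + 6 * A ^ 9 := by ring
        _ ≤ 8 * A ^ 9 := by linarith [hApow 7 9 (by norm_num)]
    have hT4 : |∑ k, 2 * (cov₂At G (ricAt G) y (e k) (e 1) (e 1) *
        cov₂At G (ricAt G) y (e k) (e 2) (e 2) - cov₂At G (ricAt G) y (e k) (e 1) (e 2) ^ 2)| ≤
        12 * A ^ 9 := by
      refine (Finset.abs_sum_le_sum_abs _ _).trans ?_
      have hk : ∀ k, |2 * (cov₂At G (ricAt G) y (e k) (e 1) (e 1) *
          cov₂At G (ricAt G) y (e k) (e 2) (e 2) - cov₂At G (ricAt G) y (e k) (e 1) (e 2) ^ 2)| ≤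
          4 * A ^ 8 := fun k ↦ by
        rw [abs_mul, show |(2 : ℝ)| = 2 from by norm_num]
        have hp : |cov₂At G (ricAt G) y (e k) (e 1) (e 1) * cov₂At G (ricAt G) y (e k) (e 2) (e 2)|
            ≤ A ^ 4 * A ^ 4 := by
          rw [abs_mul]; gcongr <;> exact hBb _ _ _
        have hq : |cov₂At G (ricAt G) y (e k) (e 1) (e 2) ^ 2| ≤ A ^ 4 * A ^ 4 := by
          rw [abs_pow, pow_two]; gcongr <;> exact hBb _ _ _
        have := abs_sub (cov₂At G (ricAt G) y (e k) (e 1) (e 1) *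
          cov₂At G (ricAt G) y (e k) (e 2) (e 2)) (cov₂At G (ricAt G) y (e k) (e 1) (e 2) ^ 2)
        nlinarith
      calc ∑ k, |2 * (cov₂At G (ricAt G) y (e k) (e 1) (e 1) *
            cov₂At G (ricAt G) y (e k) (e 2) (e 2) - cov₂At G (ricAt G) y (e k) (e 1) (e 2) ^ 2)|
          ≤ ∑ _k : Fin 3, 4 * A ^ 8 := Finset.sum_le_sum fun k _ ↦ hk k
        _ = 12 * A ^ 8 := by simp; ring
        _ ≤ 12 * A ^ 9 := by linarith [hApow 8 9 (by norm_num)]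
    have h := abs_add_four_le (μ 1 * μ 2 * (2 * lam - μ 1 - μ 2))
      (μ 2 * (2 * lam * μ 1 - μ 0 * (μ 1 + μ 0 - μ 2) - μ 2 * (μ 1 + μ 2 - μ 0)))
      (μ 1 * (2 * lam * μ 2 - μ 0 * (μ 2 + μ 0 - μ 1) - μ 1 * (μ 2 + μ 1 - μ 0)))
      (∑ k, 2 * (cov₂At G (ricAt G) y (e k) (e 1) (e 1) * cov₂At G (ricAt G) y (e k) (e 2) (e 2)
            - cov₂At G (ricAt G) y (e k) (e 1) (e 2) ^ 2))
    linarith [hTi 2 1 0, hTi 1 2 0]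
  · rw [abs_mul, show |(2 : ℝ)| = 2 from by norm_num]
    have := abs_add_le (μ 2 * cov₂At G (ricAt G) y (e k) (e 1) (e 1))
      (μ 1 * cov₂At G (ricAt G) y (e k) (e 2) (e 2))
    have h1 : |μ 2 * cov₂At G (ricAt G) y (e k) (e 1) (e 1)| ≤ A ^ 3 * A ^ 4 := by
      rw [abs_mul]; gcongr <;> first | exact hμb _ | exact hBb _ _ _
    have h2 : |μ 1 * cov₂At G (ricAt G) y (e k) (e 2) (e 2)| ≤ A ^ 3 * A ^ 4 := by
      rw [abs_mul]; gcongr <;> first | exact hμb _ | exact hBb _ _ _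
    nlinarith

end MetricCoord

end Literature.Geometry.Lorentzian

namespace Literature.Geometry.Riemannian

open Lorentzian Lorentzian.PseudoRiemannianMetric

/-! ### The null set of `Ric` is open (E. Hopf's minimum principle for `det(♯Ric)`) -/

section Local

variable {M : Type*} [TopologicalSpace M] [ChartedSpace (EuclideanSpace ℝ (Fin 3)) M]
  [IsManifold (𝓡 3) ∞ M]
  (g : PseudoRiemannianMetric (𝓡 3) ∞ (EuclideanSpace ℝ (Fin 3)) (TangentSpace (𝓡 3) : M → Type _))
  [g.HasLeviCivita]

set_option maxHeartbeats 1600000 in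
-- a long chart computation (coefficients, bounds and the verification of `𝔏u ≥ 0`)
/-- **The null set of `Ric` is open** on a three-dimensional gradient Ricci soliton
`Ric + Hess f = λ g` with `Ric ≥ 0` and `S > 0`: if `Ric_{x₀}` has a null vector then so does `Ric_x`
for all `x` near `x₀` — E. Hopf's minimum principle applied, in a chart, to the barrier
`u = det(♯Ric) ≥ 0`, which satisfies `−g^{ij}∂ᵢⱼu + bⁱ∂ᵢu + Cu ≥ 0` with bounded coefficients near
`x₀` (`MetricCoord.IsMetricOn.lapAt_ricDetAt_le_mul`, `…abs_barrierCoeff_le`; at `x₀` the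
eigenvalues are `(0, S/2, S/2)` by `ShrinkerPinchingEigenvalues`, so `μ₁μ₂ ≥ c > 0` nearby). This
replaces the smooth-eigenvector/strong-maximum-principle step of the source.
[cite: EminentiLanaveMantegazza2008, §3, p. 8] [cite: LopezGomez2012, Thm. 1.2] -/
theorem ricci_null_eventually_of_soliton (hg : g.IsRiemannian) {f : M → ℝ}
    (hf : ContMDiff (𝓡 3) 𝓘(ℝ, ℝ) ∞ f) {lam : ℝ}
    (hsol : ∀ (x : M) (X Y : TangentSpace (𝓡 3) x),
      g.ricci x X Y + g.hessian f x X Y = lam * g.val x X Y)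
    (hRic0 : ∀ (x : M) (w : TangentSpace (𝓡 3) x), 0 ≤ g.ricci x w w)
    (hS : ∀ x, 0 < g.scalarCurvature x) {x₀ : M} {w₀ : TangentSpace (𝓡 3) x₀} (hw₀ : w₀ ≠ 0)
    (hnull : g.ricci x₀ w₀ w₀ = 0) :
    ∀ᶠ x in 𝓝 x₀, ∃ w : TangentSpace (𝓡 3) x, w ≠ 0 ∧ g.ricci x w w = 0 := by
  classical
  set bE := (EuclideanSpace.basisFun (Fin 3) ℝ).toBasis with hbE
  have h3 : finrank ℝ (EuclideanSpace ℝ (Fin 3)) = 3 := finrank_euclideanSpace_fin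
  -- (0) the chart at `x₀`
  set G := chartRep (𝓡 3) (fun _ ↦ g) x₀ 0 with hGdef
  set T : Set (EuclideanSpace ℝ (Fin 3)) := (extChartAt (𝓡 3) x₀).target with hT
  have hTo : IsOpen T := isOpen_extChartAt_target x₀
  have hGm : MetricCoord.IsMetricOn G T :=
    Lorentzian.OpensChart.isMetricOn_repr (val_chartPullback_eq_chartRep (fun _ : ℝ ↦ g) x₀ 0)
  have hGpos : ∀ y ∈ T, ∀ v : EuclideanSpace ℝ (Fin 3), v ≠ 0 → 0 < G y v v := by
    intro y hy v hv
    rw [hGdef, show y = ((⟨y, hy⟩ : chartTarget (𝓡 3) x₀) : EuclideanSpace ℝ (Fin 3)) from rfl,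
      chartRep_apply]
    exact chartPullback_pos g x₀ ⟨y, hy⟩ (fun w hw ↦ hg _ w hw) v hv
  have hu₀T : extChartAt (𝓡 3) x₀ x₀ ∈ T := mem_extChartAt_target x₀
  set u₀ : EuclideanSpace ℝ (Fin 3) := extChartAt (𝓡 3) x₀ x₀ with hu₀
  have hΦu₀ : chartInv (𝓡 3) x₀ ⟨u₀, hu₀T⟩ = x₀ := extChartAt_to_inv x₀
  set fc : EuclideanSpace ℝ (Fin 3) → ℝ := f ∘ (extChartAt (𝓡 3) x₀).symm with hfc
  have hfcs : ContDiffOn ℝ ∞ fc T := by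
    rw [hfc, ← contMDiffOn_iff_contDiffOn]
    exact hf.comp_contMDiffOn (contMDiffOn_extChartAt_symm x₀)
  have hsolc := soliton_chartRep_target g x₀ hf hsol
  have hScal : ∀ y (hy : y ∈ T),
      MetricCoord.scalAt G y = g.scalarCurvature (chartInv (𝓡 3) x₀ ⟨y, hy⟩) := fun y hy ↦
    (Lorentzian.scalarCurvature_chartInv_eq g x₀ ⟨y, hy⟩).symm
  have hSpos : ∀ y ∈ T, 0 < MetricCoord.scalAt G y := fun y hy ↦ by rw [hScal y hy]; exact hS _
  have hRicc : ∀ y ∈ T, ∀ w : EuclideanSpace ℝ (Fin 3), 0 ≤ MetricCoord.ricAt G y w w := by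
    intro y hy w
    have h := hRic0 (chartInv (𝓡 3) x₀ ⟨y, hy⟩)
      (mfderiv 𝓘(ℝ, EuclideanSpace ℝ (Fin 3)) (𝓡 3) (chartInv (𝓡 3) x₀) ⟨y, hy⟩ w)
    rwa [ricci_chartInv_mfderiv_eq_ricAt] at h
  -- (1) sorted orthonormal eigenframes at all points of `T`
  have hfr : ∀ y ∈ T, ∃ (e : Basis (Fin 3) ℝ (EuclideanSpace ℝ (Fin 3))) (μ : Fin 3 → ℝ),
      (∀ i j, G y (e i) (e j) = if i = j then 1 else 0) ∧
        (∀ i w, MetricCoord.ricAt G y (e i) w = μ i * G y (e i) w) ∧ μ 0 ≤ μ 1 ∧ μ 1 ≤ μ 2 :=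
    fun y hy ↦ MetricCoord.exists_sorted_eigenframe_three h3 (hGm.symm y hy) (hGpos y hy)
      (MetricCoord.ricAt G y) (fun v w ↦ hGm.ricAt_comm hy v w)
  haveI : Nonempty (Basis (Fin 3) ℝ (EuclideanSpace ℝ (Fin 3))) := ⟨bE⟩
  choose! eB μB hON hEig hs01 hs12 using hfr
  have hdiag : ∀ y ∈ T, ∀ i, MetricCoord.ricAt G y (eB y i) (eB y i) = μB y i := fun y hy i ↦ by
    rw [hEig y hy, hON y hy]; simp
  have hμnn : ∀ y ∈ T, ∀ i, 0 ≤ μB y i := fun y hy i ↦ by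
    rw [← hdiag y hy i]; exact hRicc y hy _
  have hSsum : ∀ y ∈ T, MetricCoord.scalAt G y = μB y 0 + μB y 1 + μB y 2 := fun y hy ↦ by
    rw [MetricCoord.scalAt_eq_sum_of_eigenframe (eB y) (hON y hy) (hEig y hy)
      (hGm.isInvertible y hy), Fin.sum_univ_three]
  have hNsum : ∀ y ∈ T, MetricCoord.normSqAt G y (MetricCoord.ricAt G y) =
      μB y 0 ^ 2 + μB y 1 ^ 2 + μB y 2 ^ 2 := fun y hy ↦ by
    rw [hGm.normSqAt_ricAt_eq_sum_of_eigenframe (eB y) (hON y hy) (hEig y hy) hy,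
      Fin.sum_univ_three]
  have hu : ∀ y ∈ T, MetricCoord.ricDetAt G y = μB y 0 * μB y 1 * μB y 2 := fun y hy ↦ by
    rw [MetricCoord.ricDetAt_eq_prod_of_eigenframe (eB y) (hON y hy) (hGm.isInvertible y hy)
      (hEig y hy), Fin.prod_univ_three]
  -- the continuous lower bound `q ≤ μ₁μ₂`
  obtain ⟨q, hq⟩ : ∃ q : EuclideanSpace ℝ (Fin 3) → ℝ, q = (fun y ↦
    (MetricCoord.scalAt G y ^ 2 - MetricCoord.normSqAt G y (MetricCoord.ricAt G y)) / 2
      - 2 / 9 * MetricCoord.scalAt G y ^ 2) := ⟨_, rfl⟩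
  have hqc : ContinuousOn q T := by
    have h1 := hGm.contDiffOn_scalAt.continuousOn
    have h2 := (hGm.contDiffOn_normSqAt hGm.contDiffOn_ricAt).continuousOn
    rw [hq]
    exact (((h1.pow 2).sub h2).div_const 2).sub (continuousOn_const.mul (h1.pow 2))
  have hqle : ∀ y ∈ T, q y ≤ μB y 1 * μB y 2 := by
    intro y hy
    have h0 := hμnn y hy 0
    have h01 := hs01 y hy
    have h12 := hs12 y hy
    simp only [hq, hSsum y hy, hNsum y hy]
    nlinarith [mul_nonneg (show 0 ≤ (μB y 0 + μB y 1 + μB y 2) / 3 - μB y 0 by linarith)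
      (show 0 ≤ 2 * (μB y 0 + μB y 1 + μB y 2) / 3 - μB y 0 by linarith)]
  -- (2) at `u₀`: `μ₀ = 0`, `μ₁ = μ₂ = S/2`, so `q(u₀) > 0`
  have hq0 : μB u₀ 0 = 0 ∧ 0 < q u₀ := by
    -- a null vector in the chart
    set L := mfderiv 𝓘(ℝ, EuclideanSpace ℝ (Fin 3)) (𝓡 3) (chartInv (𝓡 3) x₀) ⟨u₀, hu₀T⟩ with hL
    have hinj : Function.Injective L := injective_mfderiv_chartInv (I := 𝓡 3) x₀ ⟨u₀, hu₀T⟩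
    have hinv := isInvertible_mfderiv_of_injective rfl hinj
    have hnull' : ∀ w : TangentSpace (𝓡 3) (chartInv (𝓡 3) x₀ ⟨u₀, hu₀T⟩), w ≠ 0 →
        ∃ w' : TangentSpace (𝓡 3) (chartInv (𝓡 3) x₀ ⟨u₀, hu₀T⟩), w' ≠ 0 ∧
          g.ricci (chartInv (𝓡 3) x₀ ⟨u₀, hu₀T⟩) w' w' = 0 := by
      intro _ _
      rw [hΦu₀]
      exact ⟨w₀, hw₀, hnull⟩
    obtain ⟨w₁, hw₁, hnull₁⟩ := hnull' w₀ hw₀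
    obtain ⟨v₀, rfl⟩ : ∃ v : EuclideanSpace ℝ (Fin 3), L v = w₁ :=
      ⟨L.inverse w₁, by rw [← ContinuousLinearMap.comp_apply, hinv.self_comp_inverse]; rfl⟩
    have hv₀ : v₀ ≠ 0 := fun h0 ↦ hw₁ (by subst h0; exact map_zero L)
    rw [hL, ricci_chartInv_mfderiv_eq_ricAt] at hnull₁
    -- `Ric(v₀, ·) = 0`
    have hRv : ∀ w, MetricCoord.ricAt G u₀ v₀ w = 0 :=
      clm_apply_eq_zero_of_nonneg_of_apply_self_eq_zero (fun v w ↦ hGm.ricAt_comm hu₀T v w)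
        (hRicc u₀ hu₀T) hnull₁
    have hμ00 : μB u₀ 0 = 0 := by
      have hcoef : ∀ i, μB u₀ i * G u₀ v₀ (eB u₀ i) = 0 := fun i ↦ by
        have h1 : MetricCoord.ricAt G u₀ (eB u₀ i) v₀ = μB u₀ i * G u₀ (eB u₀ i) v₀ := hEig u₀ hu₀T i v₀
        rw [hGm.ricAt_comm hu₀T, hRv, hGm.symm u₀ hu₀T] at h1
        exact h1.symm
      have hj : ∃ i, μB u₀ i = 0 := by
        by_contra hne
        push Not at hne
        have hc0 : ∀ i, G u₀ v₀ (eB u₀ i) = 0 := fun i ↦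
          (mul_eq_zero.mp (hcoef i)).resolve_left (hne i)
        apply hv₀
        rw [← MetricCoord.sum_apply_smul_of_orthonormal (eB u₀) (hON u₀ hu₀T) v₀]
        simp [hc0]
      obtain ⟨i, hi⟩ := hj
      have hle : μB u₀ 0 ≤ μB u₀ i := by
        fin_cases i
        · exact le_rfl
        · exact hs01 u₀ hu₀T
        · exact (hs01 u₀ hu₀T).trans (hs12 u₀ hu₀T)
      exact le_antisymm (hi ▸ hle) (hμnn u₀ hu₀T 0)
    -- the minimum-point dichotomy with `m = 0`
    have hminc : ∀ y ∈ T, ∀ w : EuclideanSpace ℝ (Fin 3),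
        0 * MetricCoord.scalAt G y * G y w w ≤ MetricCoord.ricAt G y w w := fun y hy w ↦ by
      rw [zero_mul, zero_mul]; exact hRicc y hy w
    have heq0 : MetricCoord.ricAt G u₀ (eB u₀ 0) (eB u₀ 0) =
        0 * MetricCoord.scalAt G u₀ * G u₀ (eB u₀ 0) (eB u₀ 0) := by
      rw [hdiag u₀ hu₀T, hμ00]; ring
    have hcases := hGm.eigenvalues_at_pinching_minimum_three hu₀T (hGpos _ hu₀T) hfcs hsolc
      (eB u₀) (hON u₀ hu₀T) (hEig u₀ hu₀T) hminc heq0 (hs01 u₀ hu₀T) (hs12 u₀ hu₀T) (hSpos _ hu₀T)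
    have hS0 := hSpos u₀ hu₀T
    rw [hSsum u₀ hu₀T] at hS0
    have h12 : μB u₀ 1 = μB u₀ 2 := by
      rcases hcases with ⟨-, h⟩ | ⟨h01, h12⟩
      · exact h
      · exact h12
    refine ⟨hμ00, ?_⟩
    simp only [hq, hSsum u₀ hu₀T, hNsum u₀ hu₀T, hμ00, ← h12]
    have hpos1 : 0 < μB u₀ 1 := by
      rcases hcases with ⟨-, h⟩ | ⟨h01, -⟩
      · nlinarith
      · linarith
    nlinarith
  obtain ⟨hμ00, hqu₀⟩ := hq0
  -- (3) a closed ball `K ⊆ T` around `u₀` on which `q ≥ c > 0`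
  set c : ℝ := q u₀ / 2 with hcdef
  have hc : 0 < c := by positivity
  have hqn : ∀ᶠ y in 𝓝 u₀, c < q y ∧ y ∈ T := by
    have h1 : ContinuousAt q u₀ := hqc.continuousAt (hTo.mem_nhds hu₀T)
    exact (h1.eventually (lt_mem_nhds (show c < q u₀ by rw [hcdef]; linarith))).and
      (hTo.mem_nhds hu₀T)
  obtain ⟨R, hR, hRsub⟩ := nhds_basis_closedBall.mem_iff.mp hqn
  set K : Set (EuclideanSpace ℝ (Fin 3)) := closedBall u₀ R with hK
  have hKc : IsCompact K := isCompact_closedBall u₀ R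
  have hKT : K ⊆ T := fun y hy ↦ (hRsub hy).2
  have hKq : ∀ y ∈ K, c ≤ μB y 1 * μB y 2 := fun y hy ↦
    (hRsub hy).1.le.trans (hqle y (hKT hy))
  -- (4) uniform bounds on `K`
  obtain ⟨NR, hNR⟩ := hKc.exists_bound_of_continuousOn (hGm.contDiffOn_ricAt.continuousOn.mono hKT)
  obtain ⟨NB, hNB⟩ := hKc.exists_bound_of_continuousOn
    ((hGm.contDiffOn_cov₂At hGm.contDiffOn_ricAt).continuousOn.mono hKT)
  obtain ⟨ν, hν, hνle⟩ := HamiltonMP.exists_pos_le_quadratic_of_isCompact hKc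
    (hGm.contDiffOn.continuousOn.mono hKT) fun y hy ↦ hGpos y (hKT hy)
  set A : ℝ := max 1 (max NR (max NB (max |lam| ν⁻¹))) with hA
  have hA1 : 1 ≤ A := le_max_left _ _
  have hA0 : 0 ≤ A := zero_le_one.trans hA1
  have hANR : NR ≤ A := le_max_of_le_right (le_max_left _ _)
  have hANB : NB ≤ A := le_max_of_le_right (le_max_of_le_right (le_max_left _ _))
  have hAlam : |lam| ≤ A :=
    le_max_of_le_right (le_max_of_le_right (le_max_of_le_right (le_max_left _ _)))
  have hAν : ν⁻¹ ≤ A :=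
    le_max_of_le_right (le_max_of_le_right (le_max_of_le_right (le_max_right _ _)))
  have hνA : 1 ≤ ν * A ^ 2 := by
    have h1 : 1 ≤ ν * A := by
      have := mul_le_mul_of_nonneg_left hAν hν.le
      rwa [mul_inv_cancel₀ hν.ne'] at this
    calc (1 : ℝ) ≤ ν * A := h1
      _ ≤ ν * A * A := le_mul_of_one_le_right (by positivity) hA1
      _ = ν * A ^ 2 := by ring
  have hRicA : ∀ y ∈ K, ‖MetricCoord.ricAt G y‖ ≤ A := fun y hy ↦
    ((Real.le_norm_self _).trans (by simpa using hNR y hy)).trans hANR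
  have hBA : ∀ y ∈ K, ‖MetricCoord.cov₂At G (MetricCoord.ricAt G) y‖ ≤ A := fun y hy ↦
    ((Real.le_norm_self _).trans (by simpa using hNB y hy)).trans hANB
  have heA : ∀ y ∈ K, ∀ i, ‖eB y i‖ ≤ A := fun y hy i ↦
    MetricCoord.norm_le_of_le_quadratic hν hA0 hνA (hνle y hy) (by rw [hON y (hKT hy)]; simp)
  -- (5) the data of E. Hopf's minimum principle on `Ω = ball u₀ R`
  set Ω : Set (EuclideanSpace ℝ (Fin 3)) := ball u₀ R with hΩ
  have hΩK : Ω ⊆ K := ball_subset_closedBall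
  have hΩT : Ω ⊆ T := hΩK.trans hKT
  set a : EuclideanSpace ℝ (Fin 3) → Fin 3 → Fin 3 → ℝ := fun y i j ↦ MetricCoord.ginv G bE y i j
    with ha
  -- the drift: `Σ g^{kl}Γ_{kl} + ∇f + Y`, `Y = Σ_k Y_k e_k`
  obtain ⟨Yv, hYv⟩ : ∃ Yv : EuclideanSpace ℝ (Fin 3) → EuclideanSpace ℝ (Fin 3), Yv = (fun y ↦
    ∑ k, (2 * (μB y 2 * MetricCoord.cov₂At G (MetricCoord.ricAt G) y (eB y k) (eB y 1) (eB y 1)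
      + μB y 1 * MetricCoord.cov₂At G (MetricCoord.ricAt G) y (eB y k) (eB y 2) (eB y 2))
      / (μB y 1 * μB y 2)) • eB y k) := ⟨_, rfl⟩
  obtain ⟨wc, hwc⟩ : ∃ wc : EuclideanSpace ℝ (Fin 3) → EuclideanSpace ℝ (Fin 3), wc = (fun y ↦
    (∑ k, ∑ l, MetricCoord.ginv G bE y k l • MetricCoord.chrAt G y (bE k) (bE l)) +
      MetricCoord.sharpAt G y (fderiv ℝ fc y)) := ⟨_, rfl⟩
  set wv : EuclideanSpace ℝ (Fin 3) → EuclideanSpace ℝ (Fin 3) := fun y ↦ wc y + Yv y with hwv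
  set bco : EuclideanSpace ℝ (Fin 3) → Fin 3 → ℝ := fun y i ↦ wv y i with hbco
  set C₀ : ℝ := 32 * A ^ 9 / c with hC₀
  have hC₀nn : 0 ≤ C₀ := by positivity
  -- (i) symmetry and ellipticity
  have ha_symm : ∀ y ∈ Ω, ∀ i j, a y i j = a y j i := fun y hy i j ↦
    MetricCoord.ginv_comm bE (hGm.isInvertible y (hΩT hy)) (hGm.symm y (hΩT hy)) i j
  obtain ⟨μe, hμe, hell'⟩ := MetricCoordEuclid.exists_pos_le_sum_ginv hGm hGpos hKc hKT
  have hell : ∀ y ∈ Ω, ∀ ξ : EuclideanSpace ℝ (Fin 3),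
      μe * ‖ξ‖ ^ 2 ≤ ∑ i, ∑ j, a y i j * ξ i * ξ j := fun y hy ξ ↦ hell' y (hΩK hy) ξ
  -- (ii) local boundedness of the coefficients
  have hYvb : ∀ y ∈ K, ‖Yv y‖ ≤ 3 * (4 * A ^ 7 / c * A) := by
    intro y hy
    have hyT := hKT hy
    have hcoef := (hGm.abs_barrierCoeff_le hyT (eB y) (hON y hyT) (hEig y hyT) hA1 (hRicA y hy)
      (hBA y hy) (heA y hy) hAlam).2
    have h12 : 0 < μB y 1 * μB y 2 := hc.trans_le (hKq y hy)
    simp only [hYv]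
    refine (norm_sum_le _ _).trans ?_
    calc ∑ k, ‖(2 * (μB y 2 * MetricCoord.cov₂At G (MetricCoord.ricAt G) y (eB y k) (eB y 1) (eB y 1)
            + μB y 1 * MetricCoord.cov₂At G (MetricCoord.ricAt G) y (eB y k) (eB y 2) (eB y 2))
            / (μB y 1 * μB y 2)) • eB y k‖ ≤ ∑ _k : Fin 3, 4 * A ^ 7 / c * A := by
          refine Finset.sum_le_sum fun k _ ↦ ?_
          rw [norm_smul, Real.norm_eq_abs, abs_div, abs_of_pos h12]
          have hk := hcoef k
          have h1 : |2 * (μB y 2 * MetricCoord.cov₂At G (MetricCoord.ricAt G) y (eB y k) (eB y 1) (eB y 1)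
              + μB y 1 * MetricCoord.cov₂At G (MetricCoord.ricAt G) y (eB y k) (eB y 2) (eB y 2))|
              / (μB y 1 * μB y 2) ≤ 4 * A ^ 7 / c := by
            rw [div_le_div_iff₀ h12 hc]
            calc _ ≤ 4 * A ^ 7 * c := mul_le_mul_of_nonneg_right hk hc.le
              _ ≤ 4 * A ^ 7 * (μB y 1 * μB y 2) :=
                mul_le_mul_of_nonneg_left (hKq y hy) (by positivity)
          exact mul_le_mul h1 (heA y hy k) (norm_nonneg _) (by positivity)
      _ = 3 * (4 * A ^ 7 / c * A) := by simp
  have hwcc : ContinuousOn wc T := by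
    have hA' : ContinuousOn (fun y ↦ ∑ k, ∑ l,
        MetricCoord.ginv G bE y k l • MetricCoord.chrAt G y (bE k) (bE l)) T :=
      continuousOn_finsetSum _ fun k _ ↦ continuousOn_finsetSum _ fun l _ ↦
        (hGm.contDiffOn_ginv bE k l).continuousOn.smul
          ((hGm.contDiffOn_chrAt.continuousOn.clm_apply continuousOn_const).clm_apply
            continuousOn_const)
    have hB' : ContinuousOn (fun y ↦ MetricCoord.sharpAt G y (fderiv ℝ fc y)) T :=
      hGm.contDiffOn_sharpAt.continuousOn.clm_apply
        (hfcs.continuousOn_fderiv_of_isOpen hTo (by simp))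
    rw [hwc]
    exact hA'.add hB'
  have hbdd : ∀ K' ⊆ Ω, IsCompact K' →
      ∃ C, ∀ y ∈ K', (∀ i j, |a y i j| ≤ C) ∧ (∀ i, |bco y i| ≤ C) ∧ |(fun _ ↦ C₀) y| ≤ C := by
    intro K' hK'Ω hK'
    have hK'T : K' ⊆ T := hK'Ω.trans hΩT
    obtain ⟨Ca, hCa⟩ := hK'.exists_bound_of_continuousOn
      (f := fun y ↦ ∑ i, ∑ j, |a y i j|)
      (continuousOn_finsetSum _ fun i _ ↦ continuousOn_finsetSum _ fun j _ ↦
        ((hGm.contDiffOn_ginv bE i j).continuousOn.mono hK'T).abs)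
    obtain ⟨Cw, hCw⟩ := hK'.exists_bound_of_continuousOn (hwcc.mono hK'T)
    refine ⟨max (max Ca (Cw + 3 * (4 * A ^ 7 / c * A))) C₀, fun y hy ↦ ⟨fun i j ↦ ?_, fun i ↦ ?_, ?_⟩⟩
    · refine le_trans ?_ ((le_max_left _ _).trans (le_max_left _ _))
      have h := hCa y hy
      rw [Real.norm_eq_abs, abs_of_nonneg (Finset.sum_nonneg fun _ _ ↦
        Finset.sum_nonneg fun _ _ ↦ abs_nonneg _)] at h
      exact le_trans (Finset.single_le_sum (f := fun j ↦ |a y i j|) (fun _ _ ↦ abs_nonneg _)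
        (Finset.mem_univ j) |>.trans (Finset.single_le_sum (f := fun i ↦ ∑ j, |a y i j|)
        (fun _ _ ↦ Finset.sum_nonneg fun _ _ ↦ abs_nonneg _) (Finset.mem_univ i))) h
    · refine le_trans ?_ ((le_max_right _ _).trans (le_max_left _ _))
      simp only [hbco, hwv]
      calc |(wc y + Yv y) i| ≤ ‖wc y + Yv y‖ := by
            rw [← Real.norm_eq_abs]; exact PiLp.norm_apply_le (p := 2) (wc y + Yv y) i
        _ ≤ ‖wc y‖ + ‖Yv y‖ := norm_add_le _ _
        _ ≤ Cw + 3 * (4 * A ^ 7 / c * A) := add_le_add (hCw y hy) (hYvb y (hΩK (hK'Ω hy)))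
    · simp only [abs_of_nonneg hC₀nn]
      exact le_max_right _ _
  -- (iii) the differential inequality `𝔏u ≥ 0` on `Ω`
  have hLu : ∀ y ∈ Ω, 0 ≤ -(∑ i, ∑ j, a y i j * fderiv ℝ (fderiv ℝ (MetricCoord.ricDetAt G)) y
      (EuclideanSpace.single i 1) (EuclideanSpace.single j 1)) +
      ∑ i, bco y i * fderiv ℝ (MetricCoord.ricDetAt G) y (EuclideanSpace.single i 1) +
      (fun _ ↦ C₀) y * MetricCoord.ricDetAt G y := by
    intro y hyΩ
    have hyK : y ∈ K := hΩK hyΩ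
    have hy : y ∈ T := hKT hyK
    -- first-order part
    have hfirst : ∑ i, bco y i * fderiv ℝ (MetricCoord.ricDetAt G) y (EuclideanSpace.single i 1) =
        fderiv ℝ (MetricCoord.ricDetAt G) y (wv y) := by
      conv_rhs => rw [← (EuclideanSpace.basisFun (Fin 3) ℝ).sum_repr (wv y)]
      simp only [map_sum, map_smul, smul_eq_mul, EuclideanSpace.basisFun_repr,
        EuclideanSpace.basisFun_apply, hbco]
    -- second-order part
    have hbEi : ∀ i, (bE i : EuclideanSpace ℝ (Fin 3)) = EuclideanSpace.single i 1 := fun i ↦ by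
      rw [hbE, OrthonormalBasis.coe_toBasis, EuclideanSpace.basisFun_apply]
    have hsecond : ∑ i, ∑ j, a y i j * fderiv ℝ (fderiv ℝ (MetricCoord.ricDetAt G)) y
        (EuclideanSpace.single i 1) (EuclideanSpace.single j 1) -
        fderiv ℝ (MetricCoord.ricDetAt G) y
          (∑ k, ∑ l, MetricCoord.ginv G bE y k l • MetricCoord.chrAt G y (bE k) (bE l)) =
        MetricCoord.lapAt G (MetricCoord.ricDetAt G) y := by
      rw [MetricCoord.lapAt_eq_sum G bE (MetricCoord.ricDetAt G) y]
      simp only [map_sum, map_smul, smul_eq_mul, ha, hbEi, mul_sub, Finset.sum_sub_distrib]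
    -- the barrier inequality
    have hK' := (hGm.abs_barrierCoeff_le hy (eB y) (hON y hy) (hEig y hy) hA1 (hRicA y hyK)
      (hBA y hyK) (heA y hyK) hAlam).1
    have hkey := hGm.lapAt_ricDetAt_le_mul hy h3 (eB y) (hON y hy) (hEig y hy) hfcs hsolc
      (hμnn y hy 0) (hμnn y hy 1) (hμnn y hy 2) hc (hKq y hyK) hK'
    have hwvy : fderiv ℝ (MetricCoord.ricDetAt G) y (wv y) =
        fderiv ℝ (MetricCoord.ricDetAt G) y
            (∑ k, ∑ l, MetricCoord.ginv G bE y k l • MetricCoord.chrAt G y (bE k) (bE l)) +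
          fderiv ℝ (MetricCoord.ricDetAt G) y (MetricCoord.sharpAt G y (fderiv ℝ fc y)) +
          fderiv ℝ (MetricCoord.ricDetAt G) y (Yv y) := by
      rw [hwv]
      simp only [hwc, map_add]
    rw [hfirst, hwvy]
    have h2 := hsecond
    simp only [hYv, hC₀]
    linarith
  -- (iv) E. Hopf's minimum principle: `u ≡ 0` near `u₀`
  have hu2 : ContDiffOn ℝ 2 (MetricCoord.ricDetAt G) Ω :=
    ((hGm.contDiffOn_ricDetAt_three h3).of_le (WithTop.coe_le_coe.mpr le_top)).mono hΩT
  have hum : ∀ y ∈ Ω, (0 : ℝ) ≤ MetricCoord.ricDetAt G y := fun y hy ↦ by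
    rw [hu y (hΩT hy)]
    exact mul_nonneg (mul_nonneg (hμnn y (hΩT hy) 0) (hμnn y (hΩT hy) 1)) (hμnn y (hΩT hy) 2)
  have hcn : ∀ y ∈ Ω, 0 ≤ (fun _ : EuclideanSpace ℝ (Fin 3) ↦ C₀) y := fun _ _ ↦ hC₀nn
  have huu₀ : MetricCoord.ricDetAt G u₀ = 0 := by rw [hu u₀ hu₀T, hμ00]; ring
  have hev : ∀ᶠ y in 𝓝 u₀, MetricCoord.ricDetAt G y = 0 :=
    Literature.Analysis.PDE.hopf_minimumPrinciple_eventually_eq isOpen_ball ha_symm hμe hell hbdd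
      hcn hu2 hLu le_rfl hum (mem_ball_self hR) huu₀
  -- (v) a null vector at the nearby points, back on the manifold
  have hevK : ∀ᶠ y in 𝓝 u₀, y ∈ Ω := isOpen_ball.mem_nhds (mem_ball_self hR)
  have hnullc : ∀ᶠ y in 𝓝 u₀, ∃ hy : y ∈ T, MetricCoord.ricAt G y (eB y 0) (eB y 0) = 0 := by
    filter_upwards [hev, hevK] with y hy hyΩ
    have hyT := hΩT hyΩ
    refine ⟨hyT, ?_⟩
    rw [hdiag y hyT]
    rw [hu y hyT, mul_assoc] at hy
    exact (mul_eq_zero.mp hy).resolve_right (hc.trans_le (hKq y (hΩK hyΩ))).ne'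
  have h1 : ∀ᶠ x in 𝓝 x₀, ∃ hy : extChartAt (𝓡 3) x₀ x ∈ T,
      MetricCoord.ricAt G (extChartAt (𝓡 3) x₀ x) (eB (extChartAt (𝓡 3) x₀ x) 0)
        (eB (extChartAt (𝓡 3) x₀ x) 0) = 0 :=
    (continuousAt_extChartAt (I := 𝓡 3) x₀).eventually hnullc
  filter_upwards [h1, extChartAt_source_mem_nhds (I := 𝓡 3) x₀] with x hx hxs
  obtain ⟨hy, hx0⟩ := hx
  set y := extChartAt (𝓡 3) x₀ x with hydef
  have hxy : chartInv (𝓡 3) x₀ ⟨y, hy⟩ = x := (extChartAt (𝓡 3) x₀).left_inv hxs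
  have key : ∃ w : TangentSpace (𝓡 3) (chartInv (𝓡 3) x₀ ⟨y, hy⟩), w ≠ 0 ∧
      g.ricci (chartInv (𝓡 3) x₀ ⟨y, hy⟩) w w = 0 := by
    set L := mfderiv 𝓘(ℝ, EuclideanSpace ℝ (Fin 3)) (𝓡 3) (chartInv (𝓡 3) x₀) ⟨y, hy⟩ with hL
    refine ⟨L (eB y 0), fun h0 ↦ (eB y).ne_zero 0
      (injective_mfderiv_chartInv (I := 𝓡 3) x₀ ⟨y, hy⟩ (h0.trans (map_zero L).symm)), ?_⟩
    rw [hL, ricci_chartInv_mfderiv_eq_ricAt]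
    exact hx0
  rw [hxy] at key
  exact key

/-- **Positive-definiteness of `Ric` is an open condition**: if `Ric_{x₁}(w,w) > 0` for all
`w ≠ 0` then the same holds at all points near `x₁` (a uniform lower bound at `x₁` and continuity
of the chart components `ricAt` in operator norm). [folklore] -/
theorem ricci_pos_eventually (x₁ : M)
    (hpos : ∀ w : TangentSpace (𝓡 3) x₁, w ≠ 0 → 0 < g.ricci x₁ w w) :
    ∀ᶠ x in 𝓝 x₁, ∀ w : TangentSpace (𝓡 3) x, w ≠ 0 → 0 < g.ricci x w w := by
  set G := chartRep (𝓡 3) (fun _ ↦ g) x₁ 0 with hGdef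
  set T : Set (EuclideanSpace ℝ (Fin 3)) := (extChartAt (𝓡 3) x₁).target with hT
  have hTo : IsOpen T := isOpen_extChartAt_target x₁
  have hGm : MetricCoord.IsMetricOn G T :=
    Lorentzian.OpensChart.isMetricOn_repr (val_chartPullback_eq_chartRep (fun _ : ℝ ↦ g) x₁ 0)
  have hu₁T : extChartAt (𝓡 3) x₁ x₁ ∈ T := mem_extChartAt_target x₁
  set u₁ : EuclideanSpace ℝ (Fin 3) := extChartAt (𝓡 3) x₁ x₁ with hu₁
  have hΦu₁ : chartInv (𝓡 3) x₁ ⟨u₁, hu₁T⟩ = x₁ := extChartAt_to_inv x₁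
  -- positivity at `u₁` in the chart, with a uniform constant
  have hposc : ∀ v : EuclideanSpace ℝ (Fin 3), v ≠ 0 → 0 < MetricCoord.ricAt G u₁ v v := by
    intro v hv
    have hpos' : ∀ w : TangentSpace (𝓡 3) (chartInv (𝓡 3) x₁ ⟨u₁, hu₁T⟩), w ≠ 0 →
        0 < g.ricci (chartInv (𝓡 3) x₁ ⟨u₁, hu₁T⟩) w w := by
      rw [hΦu₁]; exact hpos
    have h := hpos' (mfderiv 𝓘(ℝ, EuclideanSpace ℝ (Fin 3)) (𝓡 3) (chartInv (𝓡 3) x₁) ⟨u₁, hu₁T⟩ v)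
      (fun h0 ↦ hv (injective_mfderiv_chartInv (I := 𝓡 3) x₁ ⟨u₁, hu₁T⟩
        (h0.trans (map_zero _).symm)))
    rwa [ricci_chartInv_mfderiv_eq_ricAt] at h
  obtain ⟨ν, hν, hνle⟩ := HamiltonMP.exists_pos_le_quadratic_of_isCompact
    (B := fun _ : Unit ↦ MetricCoord.ricAt G u₁) (P := Set.univ) isCompact_univ
    continuousOn_const fun _ _ v hv ↦ hposc v hv
  have hνle' : ∀ v : EuclideanSpace ℝ (Fin 3), ν * ‖v‖ ^ 2 ≤ MetricCoord.ricAt G u₁ v v :=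
    fun v ↦ hνle () (Set.mem_univ _) v
  -- nearby points of the chart
  have hcont : ContinuousAt (MetricCoord.ricAt G) u₁ :=
    hGm.contDiffOn_ricAt.continuousOn.continuousAt (hTo.mem_nhds hu₁T)
  have hnear : ∀ᶠ y in 𝓝 u₁, dist (MetricCoord.ricAt G y) (MetricCoord.ricAt G u₁) < ν / 2 :=
    Metric.tendsto_nhds.mp hcont (ν / 2) (by positivity)
  have hposy : ∀ᶠ y in 𝓝 u₁, ∃ hy : y ∈ T, ∀ v : EuclideanSpace ℝ (Fin 3), v ≠ 0 →
      0 < MetricCoord.ricAt G y v v := by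
    filter_upwards [hnear, hTo.mem_nhds hu₁T] with y hy hyT
    refine ⟨hyT, fun v hv ↦ ?_⟩
    rw [dist_eq_norm] at hy
    have h1 : |(MetricCoord.ricAt G y - MetricCoord.ricAt G u₁) v v| ≤ ν / 2 * ‖v‖ * ‖v‖ := by
      rw [← Real.norm_eq_abs]
      exact ((MetricCoord.ricAt G y - MetricCoord.ricAt G u₁).le_opNorm₂ v v).trans
        (by gcongr)
    have h2 : (MetricCoord.ricAt G y - MetricCoord.ricAt G u₁) v v =
        MetricCoord.ricAt G y v v - MetricCoord.ricAt G u₁ v v := by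
      simp only [FunLike.coe_sub, Pi.sub_apply]
    rw [h2] at h1
    have h3 := hνle' v
    have h4 : 0 < ‖v‖ := norm_pos_iff.mpr hv
    have h5 : 0 < ν / 2 * ‖v‖ * ‖v‖ := by positivity
    have h6 := (abs_le.mp h1).1
    nlinarith
  -- back on the manifold
  have h1 : ∀ᶠ x in 𝓝 x₁, ∃ hy : extChartAt (𝓡 3) x₁ x ∈ T,
      ∀ v : EuclideanSpace ℝ (Fin 3), v ≠ 0 →
        0 < MetricCoord.ricAt G (extChartAt (𝓡 3) x₁ x) v v :=
    (continuousAt_extChartAt (I := 𝓡 3) x₁).eventually hposy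
  filter_upwards [h1, extChartAt_source_mem_nhds (I := 𝓡 3) x₁] with x hx hxs
  obtain ⟨hy, hx0⟩ := hx
  set y := extChartAt (𝓡 3) x₁ x with hydef
  have hxy : chartInv (𝓡 3) x₁ ⟨y, hy⟩ = x := (extChartAt (𝓡 3) x₁).left_inv hxs
  set L := mfderiv 𝓘(ℝ, EuclideanSpace ℝ (Fin 3)) (𝓡 3) (chartInv (𝓡 3) x₁) ⟨y, hy⟩ with hL
  have hinj : Function.Injective L := injective_mfderiv_chartInv (I := 𝓡 3) x₁ ⟨y, hy⟩
  have hinv := isInvertible_mfderiv_of_injective rfl hinj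
  have key : ∀ w : TangentSpace (𝓡 3) (chartInv (𝓡 3) x₁ ⟨y, hy⟩), w ≠ 0 →
      0 < g.ricci (chartInv (𝓡 3) x₁ ⟨y, hy⟩) w w := by
    intro w hw
    obtain ⟨v, rfl⟩ : ∃ v : EuclideanSpace ℝ (Fin 3), L v = w :=
      ⟨L.inverse w, by rw [← ContinuousLinearMap.comp_apply, hinv.self_comp_inverse]; rfl⟩
    have hv : v ≠ 0 := fun h0 ↦ hw (by subst h0; exact map_zero L)
    rw [hL, ricci_chartInv_mfderiv_eq_ricAt]
    exact hx0 v hv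
  rw [hxy] at key
  exact key

end Local

/-! ### The compact classification -/

namespace ThreeShrinker

/-- **No degenerate compact shrinker** (Eminenti–La Nave–Mantegazza 2008, §3, second case): on
a compact connected three-dimensional gradient shrinking soliton `Ric + Hess φ = ½ h` with
`Ric ≥ 0`, `Ric` has no null vector anywhere. The null set is open
(`ricci_null_eventually_of_soliton`, E. Hopf's minimum principle for `det(♯Ric)`) and closed
(`ricci_pos_eventually`), hence all of `N`; but at a maximum point of `φ` a null vector `w`
would give `Hess φ(w,w) = ½|w|² > 0`, contradicting `hessian_apply_self_nonpos_of_isLocalMax`.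
[cite: EminentiLanaveMantegazza2008, §3, p. 8] -/
theorem not_ricci_degenerate_of_compactSpace (N : Type*) [TopologicalSpace N] [T2Space N]
    [ChartedSpace (EuclideanSpace ℝ (Fin 3)) N] [IsManifold (𝓡 3) ∞ N] [CompactSpace N]
    [ConnectedSpace N]
    (h : PseudoRiemannianMetric (𝓡 3) ∞ (EuclideanSpace ℝ (Fin 3))
      (TangentSpace (𝓡 3) : N → Type _)) [h.HasLeviCivita] (hh : h.IsRiemannian)
    (φ : N → ℝ) (hφ : ContMDiff (𝓡 3) 𝓘(ℝ, ℝ) ∞ φ)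
    (hsol : ∀ (x : N) (X Y : TangentSpace (𝓡 3) x),
      h.ricci x X Y + h.hessian φ x X Y = (1 / 2 : ℝ) * h.val x X Y)
    (hRic0 : ∀ (x : N) (w : TangentSpace (𝓡 3) x), 0 ≤ h.ricci x w w)
    {p : N} {w₀ : TangentSpace (𝓡 3) p} (hw₀ : w₀ ≠ 0) (hnull : h.ricci p w₀ w₀ = 0) : False := by
  have hS : ∀ x, 0 < h.scalarCurvature x := scalarCurvature_pos_of_compactSpace N h φ hh hφ hsol
  set Z : Set N := {x | ∃ w : TangentSpace (𝓡 3) x, w ≠ 0 ∧ h.ricci x w w = 0} with hZ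
  have hZo : IsOpen Z := by
    rw [isOpen_iff_mem_nhds]
    rintro x ⟨w, hw, hx⟩
    exact ricci_null_eventually_of_soliton h hh hφ hsol hRic0 hS hw hx
  have hZc : IsClosed Z := by
    rw [← isOpen_compl_iff, isOpen_iff_mem_nhds]
    intro x hx
    have hpos : ∀ w : TangentSpace (𝓡 3) x, w ≠ 0 → 0 < h.ricci x w w := fun w hw ↦
      lt_of_le_of_ne (hRic0 x w) fun h0 ↦ hx ⟨w, hw, h0.symm⟩
    filter_upwards [ricci_pos_eventually h x hpos] with x' hx'
    rintro ⟨w, hw, h0⟩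
    exact (hx' w hw).ne' h0
  have hZu : Z = Set.univ := IsClopen.eq_univ ⟨hZc, hZo⟩ ⟨p, w₀, hw₀, hnull⟩
  -- a maximum point of `φ`
  obtain ⟨xM, -, hmax⟩ := isCompact_univ.exists_isMaxOn Set.univ_nonempty
    hφ.continuous.continuousOn
  have hloc : IsLocalMax φ xM := Filter.Eventually.of_forall fun x ↦ hmax (Set.mem_univ x)
  obtain ⟨w, hw, hnullM⟩ : xM ∈ Z := by rw [hZu]; exact Set.mem_univ _
  have hH := h.hessian_apply_self_nonpos_of_isLocalMax
    (hφ.contMDiffAt.of_le (WithTop.coe_le_coe.mpr le_top)) hloc w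
  have hsolM := hsol xM w w
  rw [hnullM, zero_add] at hsolM
  have hpos := hh xM w hw
  rw [hsolM] at hH
  linarith

/-- **The compact case of `threeShrinkerClassification_modelData`.** Every COMPACT member of the
binder of the fact (complete, connected, three-dimensional gradient shrinking soliton
`Ric + Hess φ = ½ h`, `R + |∇φ|² = φ`) satisfies its conclusion: by
`modelData_or_ricci_degenerate_of_compactSpace` (Ivey's theorem through the minimum-point
analysis of Eminenti–La Nave–Mantegazza) and `not_ricci_degenerate_of_compactSpace` (the
degenerate alternative is impossible). In fact alternative (a) holds: `R ≡ 3/2`, `φ ≡ 3/2`,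
`Vol = 16π²/k` (a quotient of the round `S³` of scalar curvature `3/2`).
[cite: EminentiLanaveMantegazza2008, §3 (pp. 7–8), Prop. 3.7] [cite: MunteanuWang2016, Thm. 1.2 (p. 3)] -/
theorem modelData_of_compactSpace (N : Type*) [TopologicalSpace N] [T2Space N]
    [ChartedSpace (EuclideanSpace ℝ (Fin 3)) N] [IsManifold (𝓡 3) ∞ N] [CompactSpace N]
    [ConnectedSpace N] [MeasurableSpace N] [BorelSpace N] [T3Space N]
    (h : PseudoRiemannianMetric (𝓡 3) ∞ (EuclideanSpace ℝ (Fin 3))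
      (TangentSpace (𝓡 3) : N → Type _)) [h.HasLeviCivita] (hh : h.IsRiemannian)
    (φ : N → ℝ) (hφ : ContMDiff (𝓡 3) 𝓘(ℝ, ℝ) ∞ φ)
    (hsol : ∀ (x : N) (X Y : TangentSpace (𝓡 3) x),
      h.ricci x X Y + h.hessian φ x X Y = (1 / 2 : ℝ) * h.val x X Y)
    (hnorm : ∀ x : N, h.scalarCurvature x + h.gradSq φ x = φ x) :
    ((∀ x : N, h.scalarCurvature x = 0) ∧
        ∫⁻ x, ENNReal.ofReal (Real.exp (-φ x))
            ∂(riemannianMeasure (h.toContMDiffRiemannianMetric hh)) =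
          ENNReal.ofReal (8 * Real.pi * Real.sqrt Real.pi)) ∨
      (CompactSpace N ∧ (∀ x : N, h.scalarCurvature x = 3 / 2) ∧ (∀ x : N, φ x = 3 / 2) ∧
        ∃ k : ℕ, 0 < k ∧
          riemannianMeasure (h.toContMDiffRiemannianMetric hh) Set.univ =
            ENNReal.ofReal (16 * Real.pi ^ 2 / k)) ∨
      ((∀ x : N, h.scalarCurvature x = 1) ∧
        ∫⁻ x, ENNReal.ofReal (Real.exp (-φ x))
            ∂(riemannianMeasure (h.toContMDiffRiemannianMetric hh)) =
          ENNReal.ofReal (16 * Real.pi * Real.sqrt Real.pi * Real.exp (-1))) ∨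
      ((∀ x : N, h.scalarCurvature x = 1) ∧
        ∫⁻ x, ENNReal.ofReal (Real.exp (-φ x))
            ∂(riemannianMeasure (h.toContMDiffRiemannianMetric hh)) =
          ENNReal.ofReal (8 * Real.pi * Real.sqrt Real.pi * Real.exp (-1))) := by
  rcases modelData_or_ricci_degenerate_of_compactSpace N h hh φ hφ hsol hnorm with hT | hdeg
  · exact hT
  · obtain ⟨hRic0, p, w₀, hw₀, hnull⟩ := hdeg
    exact (not_ricci_degenerate_of_compactSpace N h hh φ hφ hsol hRic0 hw₀ hnull).elim

end ThreeShrinker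

end Literature.Geometry.Riemannian
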